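import Summits.QuantumFields.YangMills.Theorems.LuscherReductionTwistedTraceScalingInnerSlowManifold
import Summits.QuantumFields.YangMills.Theorems.FlatTubeReductionValleyRelocalisationReorthogonalise
import HarnessLib

/-!
# C4 INNER, brick G3: the KINETIC SPLIT on the product chart — `tc(W·constLift u, W'·constLift u') = L³·tc₁(u,u') + tc(W,W') − 2|E| + (second-order cross terms)`
# (lane A of S-BASE, crux `TwistedTraceScaling` stmt-QuantumFields-20203; sub-target C4, design note `pub/ym-fleet/ym-luscher-20007-p1/COARSE-DESIGN.md` §21.9 (3))

By cyclicity of the trace the time-like coupling of two chart points `U = W·constLift u`, `V = W'·constLift u'` only sees the PRODUCT of the stiff relative step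
`B_e = W'_e⁻¹W_e` and the slow relative step `A_k = u_k u'_k⁻¹`: `Re tr(U_e V_e⁻¹) = Re tr(B_e A_k) = 2(b₀a₀ − b⃗_e·a⃗_k)`.  Hence the EXACT split
`tc(U,V) = L³·tc₁(u,u') + tc(W,W') − 2|E| + 2Σ_e(1 − a₀^{k(e)})(1 − b₀^e) − 2Σ_e a⃗_{k(e)}·b⃗_e`:
the one-site kinetic term at coupling `L³β` (`timeCoupling_constLift`) plus the stiff kinetic term, plus cross terms which are SECOND ORDER — the last one because a stiff
step has zero direction sums (`Σ_{x} w(x,k) = 0`, `sum_dir_eq_zero_of_mem_stiff`), so `Σ_{e ∈ dir k} b⃗_e = Σ_e [(b'₀−1)w_e − (b₀−1)w'_e − w'_e × w_e]` has no linear part.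
* §1 `scalarPart_chartLink_mul_inv` (cyclicity + quaternion product), ★ `timeCoupling_chart_eq` (the exact split);
* §2 `sum_dir_eq_zero_of_mem_stiff`; ★ `sum_dir_vecPart_relStep_eq` (the direction sum of `b⃗` without linear part);
* §3 ★★ `abs_kineticCross_le` — `|Σ_e a⃗_{k(e)}·b⃗_e| ≤ (max_k |a⃗_k|)·3|E|·(τ'²τ + τ²τ' + ττ')` for hemisphere links with `|w_e| ≤ τ`, `|w'_e| ≤ τ'`
  (at `|a⃗| ≍ β^{−1/2}`, `τ ≍ τ' ≍ β^{−1/2}`: `β × this = O(β^{−1/2})`, AFFORDABLE pointwise), and `0 ≤ Σ_e(1−a₀)(1−b₀) ≤ |E|·(max_k(1−a₀^k))·τ… `.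
HONEST FRAMING: quaternion algebra on a fixed lattice for a stub of a child of the CONDITIONAL reduction route (femto rung R2b1); not infinite volume, not a gap, not Clay.

## References
* M. Lüscher, Nucl. Phys. B219 (1983) 233, §3. [Luscher1983]
* T. Bröcker, T. tom Dieck, *Representations of Compact Lie Groups* (1985), I (1.10) (quaternion multiplication). [BrockerTomDieck1985]
-/

set_option autoImplicit false

noncomputable section

open Finset Real Module
open scoped BigOperators InnerProductSpace RealInnerProductSpace Matrix
open Literature.MathematicalPhysics.QuantumFieldTheory
open Literature.MathematicalPhysics.QuantumLattice

namespace Summit.QuantumFields.YangMills.Theorems.FemtoTransferGap.TwoLattice.Toron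

open Summit.QuantumFields.YangMills.Theorems.FemtoTransferGap
open Summit.QuantumFields.YangMills.Theorems.FemtoTransferGap.TwoLattice
open Summit.QuantumFields.YangMills.Theorems.FemtoTransferGap.TwoLattice.Stiff
open Summit.QuantumFields.YangMills.Theorems.FemtoTransferGap.TwoLattice.Cov

variable {L : ℕ} [NeZero L]

/-! ## §1 Cyclicity: the coupling sees only `B_e · A_k` -/

omit [NeZero L] in
/-- `Re tr((W_e u)(W'_e u')⁻¹) = Re tr((W'_e⁻¹ W_e)(u u'⁻¹))` (cyclicity of the trace). [folklore] -/
theorem re_trace_chartLink (We We' u u' : SU2) :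
    (((We * u * (We' * u')⁻¹ : SU2) : Matrix (Fin 2) (Fin 2) ℂ).trace).re = (((We'⁻¹ * We * (u * u'⁻¹) : SU2) : Matrix (Fin 2) (Fin 2) ℂ).trace).re := by
  have e1 : We * u * (We' * u')⁻¹ = We * (u * u'⁻¹) * We'⁻¹ := by group
  rw [e1, Submonoid.coe_mul, Matrix.trace_mul_comm, ← Submonoid.coe_mul]
  congr 3
  group

omit [NeZero L] in
/-- In quaternion parts: `Re tr((W'⁻¹W)(uu'⁻¹)) = 2(b₀a₀ − b⃗·a⃗)`. [cite: BrockerTomDieck1985, I (1.10)] -/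
theorem re_trace_chartLink_eq_parts (We We' u u' : SU2) :
    (((We * u * (We' * u')⁻¹ : SU2) : Matrix (Fin 2) (Fin 2) ℂ).trace).re =
      2 * (scalarPart (We'⁻¹ * We) * scalarPart (u * u'⁻¹) - vecPart (We'⁻¹ * We) ⬝ᵥ vecPart (u * u'⁻¹)) := by
  rw [re_trace_chartLink, re_trace_eq_two_mul_scalarPart, scalarPart_mul]

omit [NeZero L] in
/-- Links of a chart point `W · constLift u`. [folklore] -/
theorem chart_mul_apply (W : GaugeConfig 3 L SU2) (u : GaugeConfig 3 1 SU2) (e : Edge 3 L) : (W * constLift L u) e = W e * u (0, e.2) := rfl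

/-- ★ **THE EXACT KINETIC SPLIT**: with `A_k = u_k u'_k⁻¹`, `B_e = W'_e⁻¹ W_e`:
`tc(W·constLift u, W'·constLift u') = L³·tc₁(u,u') + tc(W,W') − 2|E| + 2Σ_e (1 − a₀^{k(e)})(1 − b₀^e) − 2Σ_e b⃗_e·a⃗_{k(e)}`. [cite: Luscher1983, §3] -/
theorem timeCoupling_chart_eq (W W' : GaugeConfig 3 L SU2) (u u' : GaugeConfig 3 1 SU2) :
    timeCoupling su2Rep (W * constLift L u) (W' * constLift L u') =
      (L : ℝ) ^ 3 * timeCoupling su2Rep u u' + timeCoupling su2Rep W W' - 2 * Fintype.card (Edge 3 L) +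
        2 * ∑ e : Edge 3 L, (1 - scalarPart (u (0, e.2) * (u' (0, e.2))⁻¹)) * (1 - scalarPart ((W' e)⁻¹ * W e)) -
        2 * ∑ e : Edge 3 L, vecPart ((W' e)⁻¹ * W e) ⬝ᵥ vecPart (u (0, e.2) * (u' (0, e.2))⁻¹) := by
  -- the one-site term, lifted
  have h1 : (L : ℝ) ^ 3 * timeCoupling su2Rep u u' = ∑ e : Edge 3 L, 2 * scalarPart (u (0, e.2) * (u' (0, e.2))⁻¹) := by
    rw [← timeCoupling_constLift su2Rep L u u']
    unfold timeCoupling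
    exact Finset.sum_congr rfl fun e _ => by rw [constLift_apply, constLift_apply, TubeMax.re_trace_su2Rep]
  -- the stiff term
  have h2 : timeCoupling su2Rep W W' = ∑ e : Edge 3 L, 2 * scalarPart ((W' e)⁻¹ * W e) := by
    unfold timeCoupling
    refine Finset.sum_congr rfl fun e _ => ?_
    rw [TubeMax.re_trace_su2Rep]
    congr 1
    -- `scalarPart (W W'⁻¹) = scalarPart (W'⁻¹ W)` (class function)
    have : W e * (W' e)⁻¹ = (W' e) * ((W' e)⁻¹ * W e) * (W' e)⁻¹ := by group
    rw [this, scalarPart_conj]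
  have h3 : (2 : ℝ) * Fintype.card (Edge 3 L) = ∑ _e : Edge 3 L, (2 : ℝ) := by
    rw [Finset.sum_const, Finset.card_univ, nsmul_eq_mul, mul_comm]
  have h4 : timeCoupling su2Rep (W * constLift L u) (W' * constLift L u') =
      ∑ e : Edge 3 L, 2 * (scalarPart ((W' e)⁻¹ * W e) * scalarPart (u (0, e.2) * (u' (0, e.2))⁻¹) -
        vecPart ((W' e)⁻¹ * W e) ⬝ᵥ vecPart (u (0, e.2) * (u' (0, e.2))⁻¹)) := by
    unfold timeCoupling
    refine Finset.sum_congr rfl fun e _ => ?_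
    rw [chart_mul_apply, chart_mul_apply, show su2Rep (W e * u (0, e.2) * (W' e * u' (0, e.2))⁻¹) =
      ((W e * u (0, e.2) * (W' e * u' (0, e.2))⁻¹ : SU2) : Matrix (Fin 2) (Fin 2) ℂ) from fundamentalRep_apply _, re_trace_chartLink_eq_parts]
  rw [h4]
  rw [h1, h2, h3, Finset.mul_sum, Finset.mul_sum, ← Finset.sum_add_distrib, ← Finset.sum_sub_distrib, ← Finset.sum_add_distrib, ← Finset.sum_sub_distrib]
  exact Finset.sum_congr rfl fun e _ => by ring

/-! ## §2 Stiff steps have zero direction sums -/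

omit [NeZero L] in
/-- The direction/colour indicator constant mode. [folklore] -/
theorem indicator_mem_constModes (k a : Fin 3) :
    (WithLp.toLp 2 (fun ea : Edge 3 L × Fin 3 => if ea.1.2 = k ∧ ea.2 = a then (1 : ℝ) else 0) : LinkSpace L) ∈ constModes L := by
  intro y; ext ⟨⟨x, i⟩, c⟩; simp [shiftLink_apply]

/-- The inner product with the indicator constant mode is the direction sum. [folklore] -/
theorem inner_indicator_eq_sum_dir (w : LinkSpace L) (k a : Fin 3) :
    ⟪(WithLp.toLp 2 (fun ea : Edge 3 L × Fin 3 => if ea.1.2 = k ∧ ea.2 = a then (1 : ℝ) else 0) : LinkSpace L), w⟫_ℝ = ∑ x : Site 3 L, w ((x, k), a) := by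
  rw [PiLp.inner_apply]
  simp only [RCLike.inner_apply, conj_trivial]
  have e1 : ∀ i : Edge 3 L × Fin 3, w i * (WithLp.toLp 2 (fun ea : Edge 3 L × Fin 3 => if ea.1.2 = k ∧ ea.2 = a then (1 : ℝ) else 0) : LinkSpace L) i =
      if i.1.2 = k ∧ i.2 = a then w i else 0 := fun i => by
    show w i * (if i.1.2 = k ∧ i.2 = a then (1 : ℝ) else 0) = _
    split_ifs <;> simp
  rw [Finset.sum_congr rfl fun i _ => e1 i, Fintype.sum_prod_type]
  have e2 : ∀ e : Edge 3 L, (∑ c : Fin 3, if e.2 = k ∧ c = a then w (e, c) else 0) = if e.2 = k then w (e, a) else 0 := fun e => by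
    by_cases h : e.2 = k
    · simp [h]
    · simp [h]
  rw [Finset.sum_congr rfl fun e _ => e2 e, Fintype.sum_prod_type, Finset.sum_comm]
  simp [Finset.sum_ite_eq']

/-- ★ A stiff vector has zero direction sums: `Σ_x w((x,k),a) = 0`. [cite: Luscher1983, §3] -/
theorem sum_dir_eq_zero_of_mem_stiff {w : LinkSpace L} (hw : w ∈ stiffSpace L) (k a : Fin 3) : ∑ x : Site 3 L, w ((x, k), a) = 0 := by
  rw [← inner_indicator_eq_sum_dir]
  exact inner_eq_zero_of_mem_constModes_of_mem_stiff (indicator_mem_constModes (L := L) k a) hw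

/-- The vector part of the stiff relative step: `vec(W'⁻¹W) = b'₀ w − b₀ w' − w' × w`. [cite: BrockerTomDieck1985, I (1.10)] -/
theorem vecPart_inv_mul (We We' : SU2) :
    vecPart (We'⁻¹ * We) = scalarPart We' • vecPart We - scalarPart We • vecPart We' - vecPart We' ⨯₃ vecPart We := by
  rw [vecPart_mul, scalarPart_inv, vecPart_inv, smul_neg]
  have : (-vecPart We') ⨯₃ vecPart We = -(vecPart We' ⨯₃ vecPart We) := by rw [LinearMap.map_neg₂]
  rw [this]; abel

/-- ★ The direction sum of `b⃗` for STIFF steps: the linear parts cancel, `Σ_{x} b⃗_{(x,k)} = Σ_x [(b'₀−1)w − (b₀−1)w' − w'×w]`. [cite: Luscher1983, §3] -/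
theorem sum_dir_vecPart_relStep_eq (W W' : GaugeConfig 3 L SU2) (hW : linkVec L W ∈ stiffSpace L) (hW' : linkVec L W' ∈ stiffSpace L) (k a : Fin 3) :
    ∑ x : Site 3 L, vecPart ((W' (x, k))⁻¹ * W (x, k)) a =
      ∑ x : Site 3 L, ((scalarPart (W' (x, k)) - 1) * vecPart (W (x, k)) a - (scalarPart (W (x, k)) - 1) * vecPart (W' (x, k)) a -
        (vecPart (W' (x, k)) ⨯₃ vecPart (W (x, k))) a) := by
  have h0 := sum_dir_eq_zero_of_mem_stiff hW k a
  have h0' := sum_dir_eq_zero_of_mem_stiff hW' k a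
  simp only [linkVec_apply] at h0 h0'
  simp_rw [vecPart_inv_mul]
  simp only [Pi.sub_apply, Pi.smul_apply, smul_eq_mul]
  have e : ∀ x : Site 3 L, scalarPart (W' (x, k)) * vecPart (W (x, k)) a - scalarPart (W (x, k)) * vecPart (W' (x, k)) a - (vecPart (W' (x, k)) ⨯₃ vecPart (W (x, k))) a =
      ((scalarPart (W' (x, k)) - 1) * vecPart (W (x, k)) a - (scalarPart (W (x, k)) - 1) * vecPart (W' (x, k)) a - (vecPart (W' (x, k)) ⨯₃ vecPart (W (x, k))) a)
        + (vecPart (W (x, k)) a - vecPart (W' (x, k)) a) := fun x => by ring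
  rw [Finset.sum_congr rfl fun x _ => e x, Finset.sum_add_distrib]
  have hz : ∑ x : Site 3 L, (vecPart (W (x, k)) a - vecPart (W' (x, k)) a) = 0 := by
    rw [Finset.sum_sub_distrib, h0, h0', sub_zero]
  rw [hz, add_zero]

/-! ## §3 ★★ The cross terms are second order -/

omit [NeZero L] in
/-- Components of a cross product are bounded by the sup norms: `|(v × w)_a| ≤ 2·(max|v|)(max|w|)`. [folklore] -/
theorem abs_cross_apply_le {v w : Fin 3 → ℝ} {s t : ℝ} (hv : ∀ c, |v c| ≤ s) (hw : ∀ c, |w c| ≤ t) (a : Fin 3) : |(v ⨯₃ w) a| ≤ 2 * (s * t) := by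
  have hs : 0 ≤ s := (abs_nonneg _).trans (hv 0)
  have ht : 0 ≤ t := (abs_nonneg _).trans (hw 0)
  have hprod : ∀ i j, |v i * w j| ≤ s * t := fun i j => by rw [abs_mul]; exact mul_le_mul (hv i) (hw j) (abs_nonneg _) hs
  fin_cases a <;> simp only [cross_apply] <;>
  · refine (abs_sub _ _).trans ?_
    linarith [hprod 0 1, hprod 1 0, hprod 1 2, hprod 2 1, hprod 2 0, hprod 0 2, hprod 0 0]

/-- ★★ **THE SLOW–STIFF KINETIC CROSS TERM IS SECOND ORDER**: for hemisphere links with `|vecPart(W_e)_c| ≤ τ`, `|vecPart(W'_e)_c| ≤ τ'`, stiff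
`linkVec W, linkVec W'`, and a slow relative step with `|vecPart(u_k u'_k⁻¹)_c| ≤ α`:
`|Σ_e b⃗_e · a⃗_{k(e)}| ≤ 3·|E|·α·(3τ'²τ + 3τ²τ' + 2ττ')`. [cite: Luscher1983, §3] -/
theorem abs_kineticCross_le (W W' : GaugeConfig 3 L SU2) (u u' : GaugeConfig 3 1 SU2) {τ τ' α : ℝ}
    (hs : ∀ e, 0 ≤ scalarPart (W e)) (hs' : ∀ e, 0 ≤ scalarPart (W' e))
    (hw : ∀ e c, |vecPart (W e) c| ≤ τ) (hw' : ∀ e c, |vecPart (W' e) c| ≤ τ') (ha : ∀ k c, |vecPart (u (0, k) * (u' (0, k))⁻¹) c| ≤ α)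
    (hW : linkVec L W ∈ stiffSpace L) (hW' : linkVec L W' ∈ stiffSpace L) :
    |∑ e : Edge 3 L, vecPart ((W' e)⁻¹ * W e) ⬝ᵥ vecPart (u (0, e.2) * (u' (0, e.2))⁻¹)| ≤
      3 * Fintype.card (Edge 3 L) * α * (3 * τ' ^ 2 * τ + 3 * τ ^ 2 * τ' + 2 * (τ * τ')) := by
  have hτ : 0 ≤ τ := (abs_nonneg _).trans (hw ((0 : Site 3 L), 0) 0)
  have hτ' : 0 ≤ τ' := (abs_nonneg _).trans (hw' ((0 : Site 3 L), 0) 0)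
  have hα : 0 ≤ α := (abs_nonneg _).trans (ha 0 0)
  -- `|s − 1| ≤ Σ_c w_c² ≤ 3τ²`
  have hs1 : ∀ e, |scalarPart (W e) - 1| ≤ 3 * τ ^ 2 := fun e => by
    obtain ⟨h0, h1⟩ := Chart.one_sub_scalarPart_le (W e) (hs e)
    rw [abs_sub_comm, abs_of_nonneg h0]
    refine h1.trans ?_
    have : ∀ c, vecPart (W e) c ^ 2 ≤ τ ^ 2 := fun c => by rw [← sq_abs]; exact pow_le_pow_left₀ (abs_nonneg _) (hw e c) 2
    calc ∑ c, vecPart (W e) c ^ 2 ≤ ∑ _c : Fin 3, τ ^ 2 := Finset.sum_le_sum fun c _ => this c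
      _ = 3 * τ ^ 2 := by simp
  have hs1' : ∀ e, |scalarPart (W' e) - 1| ≤ 3 * τ' ^ 2 := fun e => by
    obtain ⟨h0, h1⟩ := Chart.one_sub_scalarPart_le (W' e) (hs' e)
    rw [abs_sub_comm, abs_of_nonneg h0]
    refine h1.trans ?_
    have : ∀ c, vecPart (W' e) c ^ 2 ≤ τ' ^ 2 := fun c => by rw [← sq_abs]; exact pow_le_pow_left₀ (abs_nonneg _) (hw' e c) 2
    calc ∑ c, vecPart (W' e) c ^ 2 ≤ ∑ _c : Fin 3, τ' ^ 2 := Finset.sum_le_sum fun c _ => this c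
      _ = 3 * τ' ^ 2 := by simp
  -- rewrite the sum over edges as Σ_k Σ_a a⃗_{k,a} · (Σ_x b_{(x,k),a}) and use §2
  have hsplit : ∑ e : Edge 3 L, vecPart ((W' e)⁻¹ * W e) ⬝ᵥ vecPart (u (0, e.2) * (u' (0, e.2))⁻¹) =
      ∑ k : Fin 3, ∑ a : Fin 3, vecPart (u (0, k) * (u' (0, k))⁻¹) a * ∑ x : Site 3 L, vecPart ((W' (x, k))⁻¹ * W (x, k)) a := by
    rw [Fintype.sum_prod_type, Finset.sum_comm]
    refine Finset.sum_congr rfl fun k _ => ?_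
    simp only [dotProduct]
    rw [Finset.sum_comm]
    refine Finset.sum_congr rfl fun a _ => ?_
    rw [Finset.mul_sum]
    exact Finset.sum_congr rfl fun x _ => by ring
  rw [hsplit]
  -- bound each `(k, a)` term
  have hterm : ∀ k a, |vecPart (u (0, k) * (u' (0, k))⁻¹) a * ∑ x : Site 3 L, vecPart ((W' (x, k))⁻¹ * W (x, k)) a| ≤
      α * (Fintype.card (Site 3 L) * (3 * τ' ^ 2 * τ + 3 * τ ^ 2 * τ' + 2 * (τ * τ'))) := fun k a => by
    rw [abs_mul, sum_dir_vecPart_relStep_eq W W' hW hW' k a]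
    refine mul_le_mul (ha k a) ?_ (abs_nonneg _) hα
    refine (Finset.abs_sum_le_sum_abs _ _).trans ?_
    have hx : ∀ x : Site 3 L, |(scalarPart (W' (x, k)) - 1) * vecPart (W (x, k)) a - (scalarPart (W (x, k)) - 1) * vecPart (W' (x, k)) a -
        (vecPart (W' (x, k)) ⨯₃ vecPart (W (x, k))) a| ≤ 3 * τ' ^ 2 * τ + 3 * τ ^ 2 * τ' + 2 * (τ * τ') := fun x => by
      have h1 : |(scalarPart (W' (x, k)) - 1) * vecPart (W (x, k)) a| ≤ 3 * τ' ^ 2 * τ := by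
        rw [abs_mul]; exact mul_le_mul (hs1' (x, k)) (hw (x, k) a) (abs_nonneg _) (by positivity)
      have h2 : |(scalarPart (W (x, k)) - 1) * vecPart (W' (x, k)) a| ≤ 3 * τ ^ 2 * τ' := by
        rw [abs_mul]; exact mul_le_mul (hs1 (x, k)) (hw' (x, k) a) (abs_nonneg _) (by positivity)
      have h3 : |(vecPart (W' (x, k)) ⨯₃ vecPart (W (x, k))) a| ≤ 2 * (τ' * τ) := abs_cross_apply_le (hw' (x, k)) (hw (x, k)) a
      calc _ ≤ |(scalarPart (W' (x, k)) - 1) * vecPart (W (x, k)) a - (scalarPart (W (x, k)) - 1) * vecPart (W' (x, k)) a| +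
            |(vecPart (W' (x, k)) ⨯₃ vecPart (W (x, k))) a| := abs_sub _ _
        _ ≤ (|(scalarPart (W' (x, k)) - 1) * vecPart (W (x, k)) a| + |(scalarPart (W (x, k)) - 1) * vecPart (W' (x, k)) a|) +
            |(vecPart (W' (x, k)) ⨯₃ vecPart (W (x, k))) a| := by gcongr; exact abs_sub _ _
        _ ≤ _ := by nlinarith [h1, h2, h3, mul_comm τ τ']
    calc ∑ x : Site 3 L, |(scalarPart (W' (x, k)) - 1) * vecPart (W (x, k)) a - (scalarPart (W (x, k)) - 1) * vecPart (W' (x, k)) a -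
          (vecPart (W' (x, k)) ⨯₃ vecPart (W (x, k))) a| ≤ ∑ _x : Site 3 L, (3 * τ' ^ 2 * τ + 3 * τ ^ 2 * τ' + 2 * (τ * τ')) := Finset.sum_le_sum fun x _ => hx x
      _ = Fintype.card (Site 3 L) * (3 * τ' ^ 2 * τ + 3 * τ ^ 2 * τ' + 2 * (τ * τ')) := by
          rw [Finset.sum_const, Finset.card_univ, nsmul_eq_mul]
  have hE : (Fintype.card (Edge 3 L) : ℝ) = 3 * Fintype.card (Site 3 L) := by
    rw [Fintype.card_prod, Fintype.card_fin]; push_cast; ring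
  calc |∑ k : Fin 3, ∑ a : Fin 3, vecPart (u (0, k) * (u' (0, k))⁻¹) a * ∑ x : Site 3 L, vecPart ((W' (x, k))⁻¹ * W (x, k)) a|
      ≤ ∑ k : Fin 3, ∑ a : Fin 3, |vecPart (u (0, k) * (u' (0, k))⁻¹) a * ∑ x : Site 3 L, vecPart ((W' (x, k))⁻¹ * W (x, k)) a| := by
        refine (Finset.abs_sum_le_sum_abs _ _).trans (Finset.sum_le_sum fun k _ => Finset.abs_sum_le_sum_abs _ _)
    _ ≤ ∑ _k : Fin 3, ∑ _a : Fin 3, α * (Fintype.card (Site 3 L) * (3 * τ' ^ 2 * τ + 3 * τ ^ 2 * τ' + 2 * (τ * τ'))) :=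
        Finset.sum_le_sum fun k _ => Finset.sum_le_sum fun a _ => hterm k a
    _ = 3 * Fintype.card (Edge 3 L) * α * (3 * τ' ^ 2 * τ + 3 * τ ^ 2 * τ' + 2 * (τ * τ')) := by
        simp only [Finset.sum_const, Finset.card_univ, Fintype.card_fin, nsmul_eq_mul]
        rw [hE]; push_cast; ring

end Summit.QuantumFields.YangMills.Theorems.FemtoTransferGap.TwoLattice.Toron

end
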